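import Mathlib
import Summits.NavierStokesRegularity.OSWSelfSimilar.TypeIIInnerLimitSwirlBound
import Literature.Analysis.FluidPDE.KNSSPoloidalAxisDecay
import HarnessLib
/-!
# The swirl bound survives the blow-up limit — LIFESPAN form (zone Z1 TEMPLATE §T1.4-I (I-2); part XII of the Z1
# dictionary; profile-refuter g4's record nit n3 on part XI, ns-blowup STATUS l.7151, landed in its USE form)

HONEST FRAMING (cell ns-blowup GROUP B «PROFILE SEARCH», zone Z1 «Type-II log-modulated DSS ansatz for axisymmetric
Navier–Stokes — the template IS the deliverable»; D-0035/D-0074). Part XI (`TypeIIInnerLimitSwirlBound`) proved that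
every pointwise limit of an axis-centred rescaled family of a classical axisymmetric solution inherits the swirl bound
`‖Γ₀‖_∞` — but quantified the family over ONE closed slab `[0, T]` on which the solution is classical and bounded
(`abs_swirl_limit_le`). The (I-2) inner limit of the TEMPLATE is extracted along `tₙ ↑ T⋆`, the LIFESPAN, where no such
closed slab exists. This file states the same facts under K8's standing hypotheses on the half-open lifespan
`[0, T⋆)` — classical on `Ico 0 T⋆`, bounded on every sub-slab `[0, T′]`, `T′ < T⋆`, axisymmetric slices, `|Γ₀| ≤ M` —
using the tree's lifespan maximum principle `Literature.Analysis.FluidPDE.abs_swirl_le_of_classical_Ico` (the constant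
`M` does not depend on the slab):

* `abs_swirl_le_of_tendsto_eventually` — closedness of the swirl bound under pointwise limits needs the family bound
  only for all LARGE `n` (`∀ᶠ n in atTop`);
* `abs_swirl_rescaled_le_of_lifespan` — every axis-centred rescaling `λ • v(t, x* + λ •)` of a slice `t ∈ [0, T⋆)`
  has `|swirl| ≤ M`;
* `abs_swirl_limit_le_of_lifespan` — hence every pointwise limit along times `tₙ ∈ [0, T⋆)` (eventually) has
  `|swirl W y| ≤ M`: the n3 repair of part XI's `abs_swirl_limit_le`;
* `eventually_mem_Ico_of_tendsto_zoom` — bookkeeping for the KNSS zoom: `tₙ → T⋆ > 0`, `λₙ → 0`, `tₙ < T⋆`, `s ≤ 0`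
  ⇒ the zoomed times `tₙ + λₙ² s` lie in `[0, T⋆)` for all large `n`;
* `abs_swirl_zoomSlice_le_of_lifespan` / `abs_swirl_ancientLimit_le_of_lifespan` — the ancient-slice form: for every
  `s ≤ 0` the slice `W(s, ·)` of a pointwise limit of the KNSS zoom `λₙ • v(tₙ + λₙ² s, xₙ* + λₙ •)` obeys
  `|swirl (W s) y| ≤ M`;
* `exists_swirl_bound_ancientLimit_of_lifespan` — packaged in exactly the hypothesis shape
  `∃ C, ∀ s < 0, ∀ y, |swirl (W s) y| ≤ C` of the OPEN Liouville problem
  `Summit.NavierStokesRegularity.NavierStokesRegularity.AxisymmetricLiouvilleBoundedSwirl`.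

**Nothing here asserts that a blow-up, a convergent zoom, a non-trivial inner object or a Liouville counterexample
exists**: IF a pointwise limit of the zoom exists, its swirl is bounded by `‖Γ₀‖_∞`. No number or word of the Z1 census
moves. «violates: n/a — dictionary»; bears_on LADDER-NS N5/Z1 → N1 linear core / N0⁻. Author: ns-blowup-profile-eng-1
g6, 2026-08-27 (repair proposed by ns-blowup-profile-refuter g4).
-/

open Real Filter Topology Set
open Literature.Analysis.FluidPDE

namespace Summit.NavierStokesRegularity.OSWSelfSimilar
namespace TypeIIModulationDictionary

/-- **The swirl bound is closed under pointwise limits (eventual form).** If `V_n(y) → W(y)` and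
`|swirl V_n (y)| ≤ M` for all large `n`, then `|swirl W (y)| ≤ M`. [new here — dictionary] -/
theorem abs_swirl_le_of_tendsto_eventually {V : ℕ → EuclideanSpace ℝ (Fin 3) → EuclideanSpace ℝ (Fin 3)}
    {W : EuclideanSpace ℝ (Fin 3) → EuclideanSpace ℝ (Fin 3)} {M : ℝ} {y : EuclideanSpace ℝ (Fin 3)}
    (hlim : Tendsto (fun n => V n y) atTop (𝓝 (W y))) (hb : ∀ᶠ n in atTop, |swirl (V n) y| ≤ M) :
    |swirl W y| ≤ M := by
  have hcont : Continuous fun v : EuclideanSpace ℝ (Fin 3) => |y 0 * v 1 - y 1 * v 0| := by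
    fun_prop
  have hconv : Tendsto (fun n => |swirl (V n) y|) atTop (𝓝 |swirl W y|) := by
    have h := (hcont.tendsto (W y)).comp hlim
    simpa [swirl, Function.comp_def] using h
  exact le_of_tendsto hconv hb

section Lifespan

variable {T ν M : ℝ} {v : ℝ → EuclideanSpace ℝ (Fin 3) → EuclideanSpace ℝ (Fin 3)}
  {q : ℝ → EuclideanSpace ℝ (Fin 3) → ℝ}

/-- **Every axis-centred rescaling of a slice of the lifespan obeys the swirl bound.** Let `ν > 0` and `(v, q)` be a
classical unforced Navier–Stokes solution on `[0, T⋆) × ℝ³` (`Ico 0 T`), bounded on every sub-slab `[0, T′]`, `T′ < T⋆`,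
with axisymmetric slices and `|swirl (v 0)| ≤ M`. Then for every `t ∈ [0, T⋆)`, every centre `x*` on the axis and
every scale `λ`, `|swirl (λ • v(t, x* + λ •)) (y)| ≤ M` — part V's `abs_swirl_modulatedProfile_le` with the slab
hypotheses replaced by K8's standing lifespan hypotheses (`abs_swirl_le_of_classical_Ico`). [new here — dictionary] -/
theorem abs_swirl_rescaled_le_of_lifespan (hν : 0 < ν) (hcl : IsClassicalNSSolutionOn (Ico 0 T) ν 0 v q)
    (haxi : ∀ t ∈ Ico 0 T, IsAxisymmetric (v t)) (hbdd : ∀ T' < T, ∃ V₀ : ℝ, ∀ t ∈ Icc 0 T', ∀ x, ‖v t x‖ ≤ V₀)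
    (hM : ∀ x, |swirl (v 0) x| ≤ M) {t : ℝ} (ht : t ∈ Ico 0 T) (lam : ℝ) {xc : EuclideanSpace ℝ (Fin 3)}
    (hxc0 : xc 0 = 0) (hxc1 : xc 1 = 0) (y : EuclideanSpace ℝ (Fin 3)) :
    |swirl (fun w => lam • v t (xc + lam • w)) y| ≤ M := by
  rw [swirl_smul_comp_axisAffine (v t) hxc0 hxc1 lam y]
  exact abs_swirl_le_of_classical_Ico hν hcl haxi hbdd hM t ht (xc + lam • y)

/-- **TEMPLATE (I-2), lifespan form (the n3 repair of part XI's `abs_swirl_limit_le`).** Under the hypotheses of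
`abs_swirl_rescaled_le_of_lifespan`, if an axis-centred rescaled family `V_n(y) = λ_n • v(t_n, x*_n + λ_n • y)` with
times `t_n ∈ [0, T⋆)` for all large `n` converges pointwise at `y` to `W(y)`, then `|swirl W (y)| ≤ M`. The times may
accumulate at the lifespan `T⋆` — no closed slab of classical existence is required. [new here — dictionary] -/
theorem abs_swirl_limit_le_of_lifespan (hν : 0 < ν) (hcl : IsClassicalNSSolutionOn (Ico 0 T) ν 0 v q)
    (haxi : ∀ t ∈ Ico 0 T, IsAxisymmetric (v t)) (hbdd : ∀ T' < T, ∃ V₀ : ℝ, ∀ t ∈ Icc 0 T', ∀ x, ‖v t x‖ ≤ V₀)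
    (hM : ∀ x, |swirl (v 0) x| ≤ M) {tn lamn : ℕ → ℝ} {xcn : ℕ → EuclideanSpace ℝ (Fin 3)}
    (htn : ∀ᶠ n in atTop, tn n ∈ Ico 0 T) (hxc : ∀ n, xcn n 0 = 0 ∧ xcn n 1 = 0)
    {W : EuclideanSpace ℝ (Fin 3) → EuclideanSpace ℝ (Fin 3)} {y : EuclideanSpace ℝ (Fin 3)}
    (hlim : Tendsto (fun n => lamn n • v (tn n) (xcn n + lamn n • y)) atTop (𝓝 (W y))) :
    |swirl W y| ≤ M := by
  refine abs_swirl_le_of_tendsto_eventually (V := fun n w => lamn n • v (tn n) (xcn n + lamn n • w)) hlim ?_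
  filter_upwards [htn] with n hn
  exact abs_swirl_rescaled_le_of_lifespan hν hcl haxi hbdd hM hn (lamn n) (hxc n).1 (hxc n).2 y

/-- **Bookkeeping for the KNSS zoom.** If `tₙ → T⋆` with `0 < T⋆`, `tₙ < T⋆` for all `n`, `λₙ → 0` and `s ≤ 0`, then
the zoomed times `tₙ + λₙ² s` lie in `[0, T⋆)` for all large `n` (`tₙ + λₙ² s ≤ tₙ < T⋆`, and
`tₙ + λₙ² s → T⋆ > 0`). [new here — dictionary] -/
theorem eventually_mem_Ico_of_tendsto_zoom (hT : 0 < T) {tn lamn : ℕ → ℝ} (htT : Tendsto tn atTop (𝓝 T))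
    (hlt : ∀ n, tn n < T) (hlam : Tendsto lamn atTop (𝓝 0)) {s : ℝ} (hs : s ≤ 0) :
    ∀ᶠ n in atTop, tn n + lamn n ^ 2 * s ∈ Ico 0 T := by
  have hconv : Tendsto (fun n => tn n + lamn n ^ 2 * s) atTop (𝓝 T) := by
    have h2 : Tendsto (fun n => lamn n ^ 2 * s) atTop (𝓝 (0 ^ 2 * s)) := (hlam.pow 2).mul_const s
    simpa using htT.add h2
  have hpos : ∀ᶠ n in atTop, 0 < tn n + lamn n ^ 2 * s := hconv.eventually (eventually_gt_nhds hT)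
  filter_upwards [hpos] with n hn
  refine ⟨hn.le, ?_⟩
  have hdown : lamn n ^ 2 * s ≤ 0 := mul_nonpos_of_nonneg_of_nonpos (sq_nonneg _) hs
  linarith [hlt n]

/-- **Every slice of the KNSS zoom obeys the swirl bound, eventually.** Under the hypotheses of
`abs_swirl_rescaled_le_of_lifespan` with `0 < T⋆`, for a zoom along `tₙ → T⋆`, `tₙ < T⋆`, `λₙ → 0`, centres `xₙ*` on
the axis, and every `s ≤ 0`: for all large `n`, `|swirl (λₙ • v(tₙ + λₙ² s, xₙ* + λₙ •)) (y)| ≤ M` for every `y`.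
[new here — dictionary] -/
theorem abs_swirl_zoomSlice_le_of_lifespan (hν : 0 < ν) (hT : 0 < T)
    (hcl : IsClassicalNSSolutionOn (Ico 0 T) ν 0 v q) (haxi : ∀ t ∈ Ico 0 T, IsAxisymmetric (v t))
    (hbdd : ∀ T' < T, ∃ V₀ : ℝ, ∀ t ∈ Icc 0 T', ∀ x, ‖v t x‖ ≤ V₀) (hM : ∀ x, |swirl (v 0) x| ≤ M)
    {tn lamn : ℕ → ℝ} {xcn : ℕ → EuclideanSpace ℝ (Fin 3)} (htT : Tendsto tn atTop (𝓝 T))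
    (hlt : ∀ n, tn n < T) (hlam : Tendsto lamn atTop (𝓝 0)) (hxc : ∀ n, xcn n 0 = 0 ∧ xcn n 1 = 0)
    {s : ℝ} (hs : s ≤ 0) :
    ∀ᶠ n in atTop, ∀ y, |swirl (fun w => lamn n • v (tn n + lamn n ^ 2 * s) (xcn n + lamn n • w)) y| ≤ M := by
  filter_upwards [eventually_mem_Ico_of_tendsto_zoom hT htT hlt hlam hs] with n hn y
  exact abs_swirl_rescaled_le_of_lifespan hν hcl haxi hbdd hM hn (lamn n) (hxc n).1 (hxc n).2 y

/-- **TEMPLATE (I-2), ancient-slice form: the inner object of the KNSS zoom carries swirl at most `‖Γ₀‖_∞`.** Under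
the hypotheses of `abs_swirl_zoomSlice_le_of_lifespan`, if for some `s ≤ 0` the zoomed slices
`y ↦ λₙ • v(tₙ + λₙ² s, xₙ* + λₙ • y)` converge pointwise to `W s`, then `|swirl (W s) y| ≤ M` for every `y`.
[new here — dictionary] -/
theorem abs_swirl_ancientLimit_le_of_lifespan (hν : 0 < ν) (hT : 0 < T)
    (hcl : IsClassicalNSSolutionOn (Ico 0 T) ν 0 v q) (haxi : ∀ t ∈ Ico 0 T, IsAxisymmetric (v t))
    (hbdd : ∀ T' < T, ∃ V₀ : ℝ, ∀ t ∈ Icc 0 T', ∀ x, ‖v t x‖ ≤ V₀) (hM : ∀ x, |swirl (v 0) x| ≤ M)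
    {tn lamn : ℕ → ℝ} {xcn : ℕ → EuclideanSpace ℝ (Fin 3)} (htT : Tendsto tn atTop (𝓝 T))
    (hlt : ∀ n, tn n < T) (hlam : Tendsto lamn atTop (𝓝 0)) (hxc : ∀ n, xcn n 0 = 0 ∧ xcn n 1 = 0)
    {W : ℝ → EuclideanSpace ℝ (Fin 3) → EuclideanSpace ℝ (Fin 3)} {s : ℝ} (hs : s ≤ 0)
    (hlim : ∀ y, Tendsto (fun n => lamn n • v (tn n + lamn n ^ 2 * s) (xcn n + lamn n • y)) atTop (𝓝 (W s y)))
    (y : EuclideanSpace ℝ (Fin 3)) : |swirl (W s) y| ≤ M := by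
  refine abs_swirl_le_of_tendsto_eventually
    (V := fun n w => lamn n • v (tn n + lamn n ^ 2 * s) (xcn n + lamn n • w)) (hlim y) ?_
  filter_upwards [abs_swirl_zoomSlice_le_of_lifespan hν hT hcl haxi hbdd hM htT hlt hlam hxc hs] with n hn
  exact hn y

/-- **The inner object lies in the bounded-swirl class of `AxisymmetricLiouvilleBoundedSwirl`.** Under the hypotheses
of `abs_swirl_zoomSlice_le_of_lifespan`, if the zoomed slices converge pointwise to `W s` for every `s < 0`, then
`∃ C, ∀ s < 0, ∀ y, |swirl (W s) y| ≤ C` (with `C = M = ‖Γ₀‖_∞`) — literally the swirl hypothesis of the OPEN Liouville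
problem `Summit.NavierStokesRegularity.NavierStokesRegularity.AxisymmetricLiouvilleBoundedSwirl` for the ancient field
`W`. Nothing asserts that such a zoom converges or that `W` is non-trivial. [new here — dictionary] -/
theorem exists_swirl_bound_ancientLimit_of_lifespan (hν : 0 < ν) (hT : 0 < T)
    (hcl : IsClassicalNSSolutionOn (Ico 0 T) ν 0 v q) (haxi : ∀ t ∈ Ico 0 T, IsAxisymmetric (v t))
    (hbdd : ∀ T' < T, ∃ V₀ : ℝ, ∀ t ∈ Icc 0 T', ∀ x, ‖v t x‖ ≤ V₀) (hM : ∀ x, |swirl (v 0) x| ≤ M)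
    {tn lamn : ℕ → ℝ} {xcn : ℕ → EuclideanSpace ℝ (Fin 3)} (htT : Tendsto tn atTop (𝓝 T))
    (hlt : ∀ n, tn n < T) (hlam : Tendsto lamn atTop (𝓝 0)) (hxc : ∀ n, xcn n 0 = 0 ∧ xcn n 1 = 0)
    {W : ℝ → EuclideanSpace ℝ (Fin 3) → EuclideanSpace ℝ (Fin 3)}
    (hlim : ∀ s < 0, ∀ y,
      Tendsto (fun n => lamn n • v (tn n + lamn n ^ 2 * s) (xcn n + lamn n • y)) atTop (𝓝 (W s y))) :
    ∃ C : ℝ, ∀ s < 0, ∀ y, |swirl (W s) y| ≤ C :=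
  ⟨M, fun s hs y =>
    abs_swirl_ancientLimit_le_of_lifespan hν hT hcl haxi hbdd hM htT hlt hlam hxc hs.le (hlim s hs) y⟩

end Lifespan

end TypeIIModulationDictionary
end Summit.NavierStokesRegularity.OSWSelfSimilar
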